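import Mathlib
import Literature.MathematicalPhysics.QuantumFieldTheory.Balaban1983to89.B14DomainGeom

/-!
# `Balaban1983to89.B14Sect1Sets` — [Balaban1988Convergent] Sect. 1, pp. 245–248: the large/small-field SETS
`P₀′, P₁, P₁′, P₁¹, Q₁, Q₁′, Ω₁` of the first renormalization step, typed VERBATIM as cube-layer geometry, with the
set algebra behind cell `GAPS.md` rows G-adv5-6 (the printed `P₁¹` collapses) and G-adv5-7 (margin) KERNEL-CHECKED

CITATION HEADER (lean-in-tree rule 2026-08-18).  Source: T. Bałaban, *Convergent renormalization expansions for
lattice gauge theories*, Commun. Math. Phys. **119**, 243–285 (1988) [Balaban1988Convergent] (cell paper B14 =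
[III]; held `paper:balaban1988-cmp119-convergent-renormalization`, journal page = PDF page + 242); the layer
operations `~`, `~ⁿ`, `~⁻ⁿ` are those of [Balaban1987RG1] (= [I], cell paper B12) (2.10) p. 257, typed in the sibling
module `…B14DomainGeom` (`enl`, `innerN`; sup-metric cube layers).  Quotations below were read on the x2 page renders
p003–p006 of the cell folder `b2b-balaban-ref1/pages/1988-cmp119-convergent-renormalization/`.  The paper is a
manuscript UNDER ADJUDICATION by the audit cell `pub-balaban`: NOTHING printed in it is asserted here.  Every
`theorem` is finite set algebra / natural-number arithmetic, proved without `sorry` and without new axioms.  NEW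
sibling module of unit `b2b-balaban-pv02` (gen 2, journal claim P14-S1-sets; B14 §1 is pv02's typing remit); it
imports `…B14DomainGeom` (same unit) and modifies nothing.

THE PRINTED TEXT.  p. 245 [PDF 3]: *"At first we introduce two additional partitions of the lattice T₁ into large
cubes. The first is a partition into cubes of the size MR₀ … The second is a partition into cubes of the size LM₂R₀,
where M₂ = L^{m₂}, and M₁ < M₂ < M. … and M will be chosen much larger than M₂. … The operation ~ applied to these
cubes means adding one layer of M₂R₀-cubes touching □. Usually this operation applied to other sets means adding one
layer of cubes taken from this family of cubes, in terms of which the sets are defined."*  p. 246 [PDF 4]: *"We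
introduce the next two partitions of the lattice T₁. The first is into cubes of the size LMR₁ … The second is into
cubes of the size L²M₂R₁. … Denote by P₀′ the union of the LMR₁-cubes intersecting P₀, and take P₀′~ (the operation ~
is determined by the LMR₁-cubes)."*; (1.4): *"where the sum is over sets P₁ ⊂ (P₀′~)ᶜ, which are unions of the
L²M₂R₁-cubes"*; *"Denote by P₁′ the union of the LMR₁-cubes intersecting P₁, and denote
P₁¹ = ((P₀′~)ᶜ ∩ (P₀′~²)ᶜ)^{(1)}. In blocks of B(P₁¹) we introduce the axial gauge fixing expression"*.  p. 247 [PDF 5],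
after (1.8): *"where the sum is over sets Q₁ ⊂ (B(P₁¹))~⁻¹ = ((B(P₁¹)ᶜ)~)ᶜ, which are unions of the L²M₂R₁-cubes"*.
p. 248 [PDF 6]: *"We take Q₁′ again as the union of LMR₁-cubes which intersect Q₁, and we surround the sets Q₁′,
(B(P₁¹)ᶜ)~ by two layers of LMR₁-cubes. Denote Ω₁ = (Q₁′~² ∪ (B(P₁¹)ᶜ)~³)ᶜ = (Q₁′~²)ᶜ ∩ (B(P₁¹))~⁻³, (1.10) thus Ω₁ is
a union of LMR₁-cubes, and a distance between Ω₁ and the union of the large field regions is at least 2LMR₁. On the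
set Ω₁~ we have only the small field characteristic functions, and it is easy to see that the functions χ₀, χ_Ax
localized in Ω₁~ are equal to 1, if A₀ is sufficiently larger than A₁."*

READING (declared, not printed).  All sets are typed as point sets of ONE lattice `Pt d = ℤᵈ` partitioned into cubes
of side `s` (= the LMR₁-cubes of T₁; `s = LMR₁` in T₁-units), `X~ⁿ = enl s n X`, `X~⁻ⁿ = innerN s n X`
(`…B14DomainGeom`).  The rescalings `X ↦ X^{(1)}` (passage to the unit lattice T₁^{(1)}) and `y ↦ B(y)` (blocks) are
SUPPRESSED: `B(P₁¹)` and `P₁¹` are identified with the region `(P₀′~)ᶜ ∩ (P₀′~²)ᶜ` they come from (as regions of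
space they coincide).  All `~` in the sentence defining `P₁¹` and in (1.10) are read with the LMR₁-cubes, as print
says for `P₀′~` and for (1.10) (*"two layers of LMR₁-cubes"*).

WHAT THIS FILE PROVES (cell GAPS G-adv5-6, G-adv5-7, C-B14s-08).
* §A layer lemmas over `…B14DomainGeom`: `enl s a (innerN s (a+b) Y) ⊆ innerN s b Y`, `enl s a (enl s (a+b) Z)ᶜ ⊆
  (enl s b Z)ᶜ`, `innerN s n (enl s m Z)ᶜ ⊆ (enl s (m+n) Z)ᶜ`.
* §B the sets: `P11Printed s P₀′ = (P₀′~)ᶜ ∩ (P₀′~²)ᶜ` AS PRINTED and its COLLAPSE `P11Printed s P₀′ = (P₀′~²)ᶜ`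
  (`P11Printed_collapse`: since `P₀′~ ⊆ P₀′~²` — row G-adv5-6's observation that, read literally, `P₁¹` does not involve
  `P₁′`, which the same sentence defines and which is used nowhere else); the two-parameter family `P11With s a b P₀′ P₁′
  = (P₀′~ᵃ)ᶜ ∩ (P₁′~ᵇ)ᶜ` containing the candidate repairs (G-adv5-6 proposes `a = 1, b = 2`); `Omega1 s Q₁′ B =
  (Q₁′~²)ᶜ ∩ B~⁻³` = the second form of (1.10), and `omega1_two_forms`: the first printed form equals it.
* §C the sentence *"a distance between Ω₁ and the union of the large field regions is at least 2LMR₁"* read as "at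
  least two full layers of LMR₁-cubes separate Ω₁ from the region", i.e. `Ω₁ ⊆ (Z~²)ᶜ`: PROVED for `Z = Q₁′` (exactly
  two layers) and for `Z = P₀′` (five layers) under the printed `P₁¹`; for `Z = P₁′` it is proved under `P11With s a b`
  with `b + 3` layers — and under the PRINTED `P₁¹` it FAILS at the level of set combinatorics:
  `printed_reading_unconstrained` exhibits admissible data (`P₀′ = ∅`, `Q₁′ = ∅`, `P₁′ =` the whole lattice, so
  `P₁ ⊂ (P₀′~)ᶜ` holds) with `P₁′ ⊆ Ω₁`.  This is the kernel form of G-adv5-6's "logical consequence".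
* §D `enl_omega1_subset`: `Ω₁~ ⊆ (Q₁′~)ᶜ ∩ B~⁻²` — the set-level support of *"On the set Ω₁~ we have only the small
  field characteristic functions"* (one layer of margin left towards `Q₁′`, two inside `B(P₁¹)`).
* §E `margin_adv5_7`: `2L²M₂R₁ < 2LMR₁ ↔ LM₂ < M` (row G-adv5-7's margin condition, natural-number arithmetic).
* §F (v2) the DECOMPOSITIONS OF UNITY (1.1), (1.4), (1.8) as one finite identity: for any finite cube family and any
  deviation function `dev` (print: `sup_{p ⊂ □~} |U(∂p) − 1|`, resp. `|U_{1,□′}(V, ∂p) − 1|`, `|U(b)U_{1,□′}⁻¹(b) − 1|`) and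
  threshold `ε` (print: `ε₀`, `ε₁L⁻²`, `2δ₀`), `Σ_{P ⊆ cubes} Π_{□ ∉ P}[dev □ < ε] · Π_{□ ∈ P}[dev □ ≥ ε] = 1`
  (`decompUnity`, from `Finset.prod_add`; p. 245: *"similar to the decomposition (7) in [16]"*).
WHAT IS *NOT* ASSERTED: which subscript is the intended one in `P₁¹`; anything about characteristic functions,
fields, or the claims *"χ₀, χ_Ax localized in Ω₁~ are equal to 1"* (that needs field regularity — rows G-adv5-6 and G-adv5-8);
nothing of the series' mathematics.  Value = typed statement + located gap, NOT summit progress.  Companion rows: cell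
`GAPS.md` C-B14s-08 (this module), G-adv5-6, G-adv5-7; `DIVERGENCE.md` D-pv02.14.
-/

namespace Literature.MathematicalPhysics.QuantumFieldTheory.Balaban1983to89.B14Sect1Sets

open Literature.MathematicalPhysics.QuantumFieldTheory.Balaban1983to89.B14DomainGeom

variable {d : ℕ}

/-! ## A. Layer lemmas (sup-metric cube layers of [I] (2.10), as typed in `…B14DomainGeom`) -/

/-- Cube-index proximity is monotone in the number of layers. [cite: Balaban1987RG1, (2.10) p.257] -/
theorem idxNear_mono {s n n' : ℕ} (h : n ≤ n') {x y : Pt d} (hn : IdxNear s n x y) : IdxNear s n' x y :=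
  fun i => le_trans (hn i) (by exact_mod_cast h)

/-- Adding `a` layers to a set shrunk by `a + b` layers stays inside the set shrunk by `b` layers:
`(Y~⁻⁽ᵃ⁺ᵇ⁾)~ᵃ ⊆ Y~⁻ᵇ`. [cite: Balaban1987RG1, (2.10) p.257] -/
theorem enl_innerN_subset (s a b : ℕ) (Y : Set (Pt d)) : enl s a (innerN s (a + b) Y) ⊆ innerN s b Y := by
  rintro x ⟨y, hy, hxy⟩
  refine ⟨?_, fun z hxz => ?_⟩
  · exact hy.2 x (idxNear_mono (Nat.le_add_right a b) hxy.symm)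
  · have h := IdxNear.triangle hxy.symm hxz
    exact hy.2 z h

/-- Adding `a` layers to the complement of `Z~⁽ᵃ⁺ᵇ⁾` stays outside `Z~ᵇ`: `((Z~⁽ᵃ⁺ᵇ⁾)ᶜ)~ᵃ ⊆ (Z~ᵇ)ᶜ`.
[cite: Balaban1987RG1, (2.10) p.257] -/
theorem enl_compl_enl_add_subset (s a b : ℕ) (hs : 0 < s) (Z : Set (Pt d)) :
    enl s a (enl s (a + b) Z)ᶜ ⊆ (enl s b Z)ᶜ := by
  rintro x ⟨y, hy, hxy⟩ hx
  apply hy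
  have : y ∈ enl s a (enl s b Z) := ⟨x, hx, hxy.symm⟩
  rw [enl_enl s b a hs Z] at this
  simpa [Nat.add_comm] using this

/-- Shrinking the complement of `Z~ᵐ` by `n` layers lands outside `Z~⁽ᵐ⁺ⁿ⁾`: `((Z~ᵐ)ᶜ)~⁻ⁿ ⊆ (Z~⁽ᵐ⁺ⁿ⁾)ᶜ`.
[cite: Balaban1987RG1, (2.10) p.257] -/
theorem innerN_compl_enl_subset (s n m : ℕ) (hs : 0 < s) (Z : Set (Pt d)) :
    innerN s n (enl s m Z)ᶜ ⊆ (enl s (m + n) Z)ᶜ := by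
  intro x hx hxZ
  rw [← enl_enl s m n hs Z] at hxZ
  obtain ⟨y, hy, hxy⟩ := hxZ
  exact hx.2 y hxy hy

/-- The empty set has empty enlargements. [folklore] -/
theorem enl_empty (s n : ℕ) : enl s n (∅ : Set (Pt d)) = ∅ := by
  ext x; simp [enl]

/-- The whole lattice is its own interior. [folklore] -/
theorem innerN_univ (s n : ℕ) : innerN s n (Set.univ : Set (Pt d)) = Set.univ := by
  ext x; simp [innerN]

/-! ## B. The printed sets -/

/-- p. 246: *"denote P₁¹ = ((P₀′~)ᶜ ∩ (P₀′~²)ᶜ)^{(1)}"* — AS PRINTED (region, rescaling `(1)` suppressed: READING).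
[cite: Balaban1988Convergent, p.246] -/
def P11Printed (s : ℕ) (P0' : Set (Pt d)) : Set (Pt d) := (enl s 1 P0')ᶜ ∩ (enl s 2 P0')ᶜ

/-- **G-adv5-6, literal collapse.** Since `P₀′~ ⊆ P₀′~²`, the printed `P₁¹` equals `(P₀′~²)ᶜ`: the factor `(P₀′~)ᶜ`
is redundant and `P₁′` (defined in the same sentence) does not enter. [cite: Balaban1988Convergent, p.246] -/
theorem P11Printed_collapse (s : ℕ) (P0' : Set (Pt d)) : P11Printed s P0' = (enl s 2 P0')ᶜ := by
  ext x
  simp only [P11Printed, Set.mem_inter_iff, Set.mem_compl_iff]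
  constructor
  · exact fun h => h.2
  · exact fun h => ⟨fun h1 => h (enl_mono_layers s (by norm_num : 1 ≤ 2) P0' h1), h⟩

/-- The two-parameter family of `P₁′`-bearing readings `(P₀′~ᵃ)ᶜ ∩ (P₁′~ᵇ)ᶜ` (row G-adv5-6 proposes `a = 1`,
`b = 2`; which subscript print intended is NOT decided here). [cite: Balaban1988Convergent, p.246] -/
def P11With (s a b : ℕ) (P0' P1' : Set (Pt d)) : Set (Pt d) := (enl s a P0')ᶜ ∩ (enl s b P1')ᶜ

/-- (1.10) p. 248, second form: *"Ω₁ = … = (Q₁′~²)ᶜ ∩ (B(P₁¹))~⁻³"* (`B` = the region `B(P₁¹)`, READING).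
[cite: Balaban1988Convergent, (1.10) p.248] -/
def Omega1 (s : ℕ) (Q1' B : Set (Pt d)) : Set (Pt d) := (enl s 2 Q1')ᶜ ∩ innerN s 3 B

/-- (1.10), the two printed forms agree: `(Q₁′~² ∪ (Bᶜ)~³)ᶜ = (Q₁′~²)ᶜ ∩ B~⁻³` (De Morgan and [I] (2.10)
`X~⁻ⁿ = ((Xᶜ)~ⁿ)ᶜ`, `innerN_eq_compl_enl_compl`). [cite: Balaban1988Convergent, (1.10) p.248] -/
theorem omega1_two_forms (s : ℕ) (Q1' B : Set (Pt d)) :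
    (enl s 2 Q1' ∪ enl s 3 Bᶜ)ᶜ = Omega1 s Q1' B := by
  rw [Omega1, Set.compl_union, innerN_eq_compl_enl_compl]

/-! ## C. *"a distance between Ω₁ and the union of the large field regions is at least 2LMR₁"* -/

/-- Towards `Q₁′`: exactly the two printed layers, `Ω₁ ⊆ (Q₁′~²)ᶜ`. [cite: Balaban1988Convergent, (1.10) p.248] -/
theorem omega1_subset_compl_enl_Q1' (s : ℕ) (Q1' B : Set (Pt d)) : Omega1 s Q1' B ⊆ (enl s 2 Q1')ᶜ :=
  fun _ hx => hx.1

/-- `Ω₁ ⊆ B~⁻³ ⊆ B`. [cite: Balaban1988Convergent, (1.10) p.248] -/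
theorem omega1_subset_innerN (s : ℕ) (Q1' B : Set (Pt d)) : Omega1 s Q1' B ⊆ innerN s 3 B :=
  fun _ hx => hx.2

/-- Towards `P₀′` under the PRINTED `P₁¹`: five layers, `Ω₁ ⊆ (P₀′~⁵)ᶜ` (`3` from `~⁻³`, `2` from `(P₀′~²)ᶜ`).
[cite: Balaban1988Convergent, p.246, (1.10) p.248] -/
theorem omega1_far_P0'_printed (s : ℕ) (hs : 0 < s) (Q1' P0' : Set (Pt d)) :
    Omega1 s Q1' (P11Printed s P0') ⊆ (enl s 5 P0')ᶜ := by
  intro x hx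
  have h3 : x ∈ innerN s 3 (enl s 2 P0')ᶜ := by
    rw [← P11Printed_collapse]; exact hx.2
  exact innerN_compl_enl_subset s 3 2 hs P0' h3

/-- Towards `P₀′` and `P₁′` under a `P₁′`-bearing reading `P11With s a b`: `a + 3` resp. `b + 3` layers.
[cite: Balaban1988Convergent, p.246, (1.10) p.248] -/
theorem omega1_far_repaired (s a b : ℕ) (hs : 0 < s) (Q1' P0' P1' : Set (Pt d)) :
    Omega1 s Q1' (P11With s a b P0' P1') ⊆ (enl s (a + 3) P0')ᶜ ∩ (enl s (b + 3) P1')ᶜ := by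
  intro x hx
  have hB := hx.2
  refine ⟨innerN_compl_enl_subset s 3 a hs P0' ?_ , innerN_compl_enl_subset s 3 b hs P1' ?_⟩
  · exact innerN_mono s 3 (fun y hy => hy.1) hB
  · exact innerN_mono s 3 (fun y hy => hy.2) hB

/-- **G-adv5-6, the logical consequence, kernel form.** Under the PRINTED `P₁¹` nothing separates `Ω₁` from `P₁′`:
there are admissible data — `P₀′ = ∅`, `Q₁′ = ∅` (all fields small in the sense of (1.1), (1.8)) and `P₁′` = the
whole lattice, a union of cubes with `P₁′ ⊆ (P₀′~)ᶜ` as (1.4) requires — for which `P₁′ ⊆ Ω₁` (indeed `Ω₁` is the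
whole lattice).  So the printed sentence *"a distance between Ω₁ and the union of the large field regions is at
least 2LMR₁"* cannot hold for the large-field region `P₁` with `P₁¹` read literally. [cite: Balaban1988Convergent,
p.246, (1.10) p.248] -/
theorem printed_reading_unconstrained :
    ∃ P0' Q1' P1' : Set (Pt 1), IsUnionOfCubes 1 P1' ∧ P1'.Nonempty ∧ P1' ⊆ (enl 1 1 P0')ᶜ ∧
      P1' ⊆ Omega1 1 Q1' (P11Printed 1 P0') := by
  refine ⟨∅, ∅, Set.univ, ?_, Set.univ_nonempty, ?_, ?_⟩
  · intro x y _; simp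
  · simp [enl_empty]
  · intro x _
    refine ⟨by simp [enl_empty], ?_⟩
    rw [P11Printed_collapse, enl_empty, Set.compl_empty, innerN_univ]
    exact Set.mem_univ x

/-! ## D. *"On the set Ω₁~ we have only the small field characteristic functions"* — the set-level support -/

/-- `Ω₁~ ⊆ (Q₁′~)ᶜ ∩ B~⁻²`: after adding one layer, one layer of margin is left towards `Q₁′` and two inside `B(P₁¹)`.
[cite: Balaban1988Convergent, (1.10) p.248] -/
theorem enl_omega1_subset (s : ℕ) (hs : 0 < s) (Q1' B : Set (Pt d)) :
    enl s 1 (Omega1 s Q1' B) ⊆ (enl s 1 Q1')ᶜ ∩ innerN s 2 B := by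
  intro x hx
  refine ⟨enl_compl_enl_add_subset s 1 1 hs Q1' (enl_mono s 1 (fun y hy => hy.1) hx),
    enl_innerN_subset s 1 2 B (enl_mono s 1 (fun y hy => hy.2) hx)⟩

/-! ## E. Row G-adv5-7's margin condition -/

/-- G-adv5-7: the margin `2LMR₁` of `Λ₁ ⊂ Ω₁~⁻²` exceeds the reach `2L²M₂R₁` iff `LM₂ < M` (for `L, R₁ > 0`).
[folklore] -/
theorem margin_adv5_7 (L M M₂ R₁ : ℕ) (hL : 0 < L) (hR : 0 < R₁) :
    2 * L ^ 2 * M₂ * R₁ < 2 * L * M * R₁ ↔ L * M₂ < M := by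
  have h2LR : 0 < 2 * L * R₁ := by positivity
  constructor
  · intro h
    by_contra hle
    push Not at hle
    have : 2 * L * M * R₁ ≤ 2 * L ^ 2 * M₂ * R₁ := by
      calc 2 * L * M * R₁ = (2 * L * R₁) * M := by ring
        _ ≤ (2 * L * R₁) * (L * M₂) := Nat.mul_le_mul_left _ hle
        _ = 2 * L ^ 2 * M₂ * R₁ := by ring
    omega
  · intro h
    calc 2 * L ^ 2 * M₂ * R₁ = (2 * L * R₁) * (L * M₂) := by ring
      _ < (2 * L * R₁) * M := Nat.mul_lt_mul_of_pos_left h h2LR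
      _ = 2 * L * M * R₁ := by ring

/-! ## F. (v2) The decompositions of unity (1.1), (1.4), (1.8) -/

/-- **(1.1)** p. 246 [PDF 4] (introduced p. 245: *"Now we introduce the decomposition of unity, similar to the
decomposition (7) in [16]:"*), verbatim: *"1 = Σ_{P₀} Π_{□ ⊂ P₀ᶜ} χ({sup_{p ⊂ □~} |U(∂p) − 1| < ε₀}) Π_{□ ⊂ P₀}
χ({sup_{p ⊂ □~} |U(∂p) − 1| ≥ ε₀}) = Σ_{P₀} χ₀(P₀ᶜ)χ₀ᶜ(P₀), (1.1) where the sum is over sets P₀, which are unions of the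
cubes of the second partition introduced above, i.e., unions of the LM₂R₀-cubes."*; (1.4) p. 246 and (1.8) p. 247
have the same shape with `|U_{1,□′}(V, ∂p) − 1| < ε₁L⁻²` resp. `|U(b)U_{1,□′}⁻¹(b) − 1| < 2δ₀`.  Typed at a fixed field
configuration: `cubes` = the finite cube family, `dev □` = the printed supremum over the cube, `ε` = the threshold, a
set `P` = a subset of the family (a union of cubes); the characteristic functions are the `0/1` values of the two
complementary conditions.  The identity is `Π_□ ([dev □ ≥ ε] + [dev □ < ε]) = 1` expanded (`Finset.prod_add`).
[cite: Balaban1988Convergent, (1.1) p.246, (1.4) p.246, (1.8) p.247] -/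
theorem decompUnity {ι : Type*} [DecidableEq ι] (cubes : Finset ι) (dev : ι → ℝ) (ε : ℝ) :
    ∑ P ∈ cubes.powerset, (∏ c ∈ cubes \ P, if dev c < ε then (1:ℝ) else 0) *
      (∏ c ∈ P, if ε ≤ dev c then (1:ℝ) else 0) = 1 := by
  set f : ι → ℝ := fun c => if ε ≤ dev c then (1:ℝ) else 0 with hf
  set g : ι → ℝ := fun c => if dev c < ε then (1:ℝ) else 0 with hg
  have h1 : ∏ c ∈ cubes, (f c + g c) = 1 := by
    refine Finset.prod_eq_one fun c _ => ?_
    by_cases hc : ε ≤ dev c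
    · simp [hf, hg, hc, not_lt.mpr hc]
    · push Not at hc
      simp [hf, hg, hc, not_le.mpr hc]
  calc ∑ P ∈ cubes.powerset, (∏ c ∈ cubes \ P, g c) * (∏ c ∈ P, f c)
      = ∑ P ∈ cubes.powerset, (∏ c ∈ P, f c) * (∏ c ∈ cubes \ P, g c) :=
        Finset.sum_congr rfl fun P _ => mul_comm _ _
    _ = ∏ c ∈ cubes, (f c + g c) := (Finset.prod_add f g cubes).symm
    _ = 1 := h1

/-- In each term of (1.1) exactly one summand is non-zero: the one with `P` = the set of cubes violating the small-field
condition (so the "sum over P₀" selects THE large-field set of the configuration). [cite: Balaban1988Convergent, (1.1) p.246] -/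
theorem decompUnity_term_eq_one_iff {ι : Type*} [DecidableEq ι] (cubes P : Finset ι) (hP : P ⊆ cubes)
    (dev : ι → ℝ) (ε : ℝ) :
    (∏ c ∈ cubes \ P, if dev c < ε then (1:ℝ) else 0) * (∏ c ∈ P, if ε ≤ dev c then (1:ℝ) else 0) = 1 ↔
      P = cubes.filter fun c => ε ≤ dev c := by
  constructor
  · intro h
    have hne : (∏ c ∈ cubes \ P, if dev c < ε then (1:ℝ) else 0) ≠ 0 ∧
        (∏ c ∈ P, if ε ≤ dev c then (1:ℝ) else 0) ≠ 0 := by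
      constructor <;> intro h0 <;> simp [h0] at h
    rw [Finset.prod_ne_zero_iff] at hne
    rw [Finset.prod_ne_zero_iff] at hne
    ext c
    simp only [Finset.mem_filter]
    constructor
    · intro hc
      refine ⟨hP hc, ?_⟩
      have := hne.2 c hc
      by_contra hlt
      exact this (by simp [hlt])
    · rintro ⟨hc, hle⟩
      by_contra hcP
      have := hne.1 c (Finset.mem_sdiff.mpr ⟨hc, hcP⟩)
      exact this (by simp [not_lt.mpr hle])
  · intro h
    subst h
    have h1 : (∏ c ∈ cubes \ cubes.filter (fun c => ε ≤ dev c), if dev c < ε then (1:ℝ) else 0) = 1 := by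
      refine Finset.prod_eq_one fun c hc => ?_
      rw [Finset.mem_sdiff, Finset.mem_filter] at hc
      have : dev c < ε := by
        by_contra hge; push Not at hge; exact hc.2 ⟨hc.1, hge⟩
      simp [this]
    have h2 : (∏ c ∈ cubes.filter (fun c => ε ≤ dev c), if ε ≤ dev c then (1:ℝ) else 0) = 1 := by
      refine Finset.prod_eq_one fun c hc => ?_
      rw [Finset.mem_filter] at hc
      simp [hc.2]
    rw [h1, h2, one_mul]

end Literature.MathematicalPhysics.QuantumFieldTheory.Balaban1983to89.B14Sect1Sets
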